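import Summits.BirchSwinnertonDyer.BirchSwinnertonDyer.Theorems.SignedBaseChangeAnticyclotomicEisensteinDivisibilityAdmdefRankOneTamagawa
import HarnessLib

/-!
# Line `admdef` (crux `AnticyclotomicEisensteinDivisibility`, stmt-BirchSwinnertonDyer-20727), rigidity road: the rank-one hypothesis in the SKELETON'S
# currency `finrank (ZMod p) Sel_p(E/K)[p] = 1` — Howard's criterion at the root mod `𝔪` as the line's texts read it

LEAD seat bsd-line-sbc-p1 (gen 29), `--supports stmt-BirchSwinnertonDyer-20727` (helper; OFF the v23 composition path).  The line's record texts ((RV₁)H,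
(RV₁)H-pinned, `Lines/admdef.lean` v23) phrase «`Sel_p(E/K)[p]` is a line» as `finrank (ZMod p) (AddSubgroup.toZModSubmodule p (selmerGroup (W⁄K) p)) = 1`
for the (unique) `ZMod p`-structure on `H¹(K, E[p])` supplied as an instance binder; `…AdmdefRankOneTamagawa` phrases it as «`Sel_p(E/K) = ℤ·s`, `s ≠ 0`».
* §1 `exists_generator_of_finrank_toZModSubmodule_eq_one` — the dictionary between the two phrasings (a `ZMod p`-line has a generator; `ZMod p`-scalars
  act through `ℕ`, `Nat.cast_smul_eq_nsmul` ∘ `ZMod.natCast_zmod_val`), for ANY additive subgroup of a `ZMod p`-module.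
* §2 `limitBaseClass_layer_zero_one_ne_zero_of_hasUnitLambda_of_finrank_eq_one` — **Howard 2006 Thm. 3.2.3 (c) at the ROOT mod `𝔪` on the all-ramified
  cell, rank one as `finrank (ZMod p) Sel_p(E/K)[p] = 1`**: [NV] `B.HasUnitLambda N` + `AcSigned.Setting` + {Hatley–Lei–Vigni 2022 Lemma 3.7, local form
  (named fact)} + (Tam) «`p ∤ c_v(E/K)` at the bad `v ∤ p`» + binder (ii) + `(N, d_K) = 1` + `p ≥ 5`, `ρ̄` onto, Heegner ⟹ `z_{0,1} ≠ 0`.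

HONEST FRAMING: theorems only (no definition, no named fact, no `sorry`); the named fact is a HYPOTHESIS; nothing about the crux, the anchors (K1) or
BSD is asserted; no summit statement is proved.  (RV₁)H itself (no [NV] hypothesis) is NOT proved.

References: [cite: Howard2006, Thm. 3.2.3 (c)] [cite: CastellaEtAl2025, Thm. 7.4, Thm. 7.5 (arXiv:2308.10474v2 pp. 30–31)] [cite: HatleyLeiVigni2022, Lemma 3.7, §1.2 (Tam)]
[cite: BurungaleCastellaKim2021, arXiv:1908.09512 Lem. 7.3, Prop. 7.4].
-/

-- D-0017: single-problem summit, the namespace repeats the problem name by design.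
set_option linter.dupNamespace false
set_option autoImplicit false

noncomputable section

open scoped Classical NumberField Pointwise

namespace Summit.BirchSwinnertonDyer.BirchSwinnertonDyer.Theorems.SignedBaseChangeAcDivAdmdefRankOneFinrank

open WeierstrassCurve NumberField IsDedekindDomain Field Module
open Literature.NumberTheory.EllipticCurves Literature.NumberTheory.GaloisRepresentations
open Literature.NumberTheory.EllipticCurves.CastellaHsuKunduLeeLiu2025
open Literature.NumberTheory.EllipticCurves.BertoliniDarmon2005
open Literature.NumberTheory.EllipticCurves.AcSigned
open Summit.BirchSwinnertonDyer.BirchSwinnertonDyer.Theorems.AdditiveKoly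
open Summit.BirchSwinnertonDyer.BirchSwinnertonDyer.Theorems.SignedBaseChangeAcDivAdmdefCoreRootOfSeenAnchor
open Summit.BirchSwinnertonDyer.BirchSwinnertonDyer.Theorems.SignedBaseChangeAcDivAdmdefRankOneTamagawa

universe u

/-! ## §1 A `ZMod p`-line has a `ℤ`-generator -/

section Line

variable {V : Type u} [AddCommGroup V] {p : ℕ} [Fact p.Prime] [Module (ZMod p) V]

/-- **A `ZMod p`-line inside an abelian group has a `ℤ`-generator**: if the additive subgroup `S ≤ V` (read as a `ZMod p`-subspace for the given
`ZMod p`-structure on `V`) has `finrank (ZMod p) S = 1`, then `S = ℤ·s` for some `s ∈ S`, `s ≠ 0` (a generator `s` over the field `ZMod p`; the scalar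
`a : ZMod p` acts as the integer `a.val`). [folklore] -/
theorem exists_generator_of_finrank_toZModSubmodule_eq_one (S : AddSubgroup V)
    (h : finrank (ZMod p) (AddSubgroup.toZModSubmodule p S) = 1) :
    ∃ s ∈ S, s ≠ 0 ∧ ∀ c ∈ S, ∃ a : ℤ, c = a • s := by
  obtain ⟨v, hv0, hgen⟩ := finrank_eq_one_iff'.mp h
  refine ⟨(v : V), (AddSubgroup.mem_toZModSubmodule p).mp v.2, fun h0 ↦ hv0 (Subtype.ext h0), fun c hc ↦ ?_⟩
  obtain ⟨a, ha⟩ := hgen ⟨c, (AddSubgroup.mem_toZModSubmodule p).mpr hc⟩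
  refine ⟨((a.val : ℕ) : ℤ), ?_⟩
  have h1 : (a • v : AddSubgroup.toZModSubmodule p S) = ⟨c, (AddSubgroup.mem_toZModSubmodule p).mpr hc⟩ := ha
  have h2 : ((a • v : AddSubgroup.toZModSubmodule p S) : V) = c := congrArg Subtype.val h1
  rw [Submodule.coe_smul] at h2
  rw [← h2, natCast_zsmul, ← Nat.cast_smul_eq_nsmul (ZMod p) a.val (v : V), ZMod.natCast_zmod_val]

end Line

/-! ## §2 Howard's criterion at the root mod `𝔪`, rank one as `finrank (ZMod p) Sel_p(E/K)[p] = 1` -/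

section Assembly

variable {K : Type} [Field K] [NumberField K] {W : WeierstrassCurve ℚ} [W.IsElliptic] [W.IsGloballyMinimal] {p : ℕ} [Fact p.Prime]
  {κ : ZpExtension K p} {γ : absoluteGaloisGroup K} {N : ℕ} {ε : ℤˣ} {B : SignedBipartiteSystem W K p κ} {𝔭 𝔭' : HeightOneSpectrum (𝓞 K)}

/-- **Howard's criterion at the root modulo `𝔪` on the all-ramified cell, with the rank-one hypothesis in the line's own currency
`finrank (ZMod p) Sel_p(E/K)[p] = 1`.**  For a signed bipartite system `B` of sign `ε` at level `N = N_E` with limit base class `z`, on the frame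
(`AcSigned.Setting`; `p ≥ 5`, `ρ̄_{E,p}` onto, every `ℓ ∣ N` split, `(N, d_K) = 1`), GIVEN the named print fact {Hatley–Lei–Vigni 2022 Lemma 3.7, local form},
(Tam) «`p ∤ c_v(E/K)` at every bad `v ∤ p`», binder (ii) «`E[p]` ramified at every `q ∣ N`», [NV] `B.HasUnitLambda N`, and — for the `ZMod p`-structure of
`H¹(K, E[p])` supplied as an instance binder (as in the line's texts (RV₁)H ∕ (RV₁)H-pinned) — `finrank (ZMod p) Sel_p(E/K)[p] = 1`: **`z_{0,1} ≠ 0`**.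
(`…RankOneTamagawa.limitBaseClass_layer_zero_one_ne_zero_of_hasUnitLambda_of_selmerGroup_line_of_tam` ∘ §1.)
[cite: Howard2006, Thm. 3.2.3 (c)] [cite: CastellaEtAl2025, Thm. 7.1 (ii), Thm. 7.4, Thm. 7.5 (arXiv:2308.10474v2 pp. 29–31)]
[cite: HatleyLeiVigni2022, Lemma 3.7, §1.2 (Tam)] [cite: BurungaleCastellaKim2021, arXiv:1908.09512 Prop. 7.4] -/
theorem limitBaseClass_layer_zero_one_ne_zero_of_hasUnitLambda_of_finrank_eq_one (hB : IsSignedBipartiteSystem W K p κ γ N ε B)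
    {z : Π n j : ℕ, (W.baseChange K).torsionH1Over ((p : ℤ) ^ j) (κ.layerSubgroup n)} (hz : B.IsLimitBaseClass z)
    (hS : Setting W K p κ 𝔭 𝔭') (hloc : hatleyLeiVigni2022_lemma37_local_signedCondition_eq_kummer W K p κ 𝔭 𝔭')
    (htam : ∀ v : HeightOneSpectrum (𝓞 K), ¬ (W.baseChange K).HasGoodReductionAt v → ((p : ℕ) : 𝓞 K) ∉ v.asIdeal →
      ¬ p ∣ ((W.baseChange K).baseChange (v.adicCompletion K)).localTamagawaNumber (v.adicCompletionIntegers K))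
    (hN : (N : ℤ) = W.conductorNorm ℤ) (h5 : 5 ≤ p) (hsurj : W.HasSurjectiveModNGaloisRep p)
    (hH : SatisfiesHeegnerHypothesis (W.conductorNorm ℤ) K) (hsp : ((Ideal.span {(p : ℤ)}).primesOver (𝓞 K)).ncard = 2)
    (hND : IsCoprime (N : ℤ) (NumberField.discr K))
    (hall : ∀ q : ℕ, q.Prime → q ∣ N → ∃ v' : HeightOneSpectrum (𝓞 ℚ), ((q : ℕ) : 𝓞 ℚ) ∈ v'.asIdeal ∧
      ∃ 𝔓 ∈ v'.primesAbove, ∃ σ ∈ 𝔓.inertia (absoluteGaloisGroup ℚ), ∃ P : W.geomTorsion (p : ℤ), σ • P ≠ P)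
    [Module (ZMod p) (Vp W K p)]
    (hrk : finrank (ZMod p) (AddSubgroup.toZModSubmodule p (selmerGroup (W.baseChange K) ((p ^ 1 : ℕ) : ℤ))) = 1)
    (hNV : B.HasUnitLambda N) : z 0 1 ≠ 0 := by
  obtain ⟨s, hs, hs0, hline⟩ := exists_generator_of_finrank_toZModSubmodule_eq_one (selmerGroup (W.baseChange K) ((p ^ 1 : ℕ) : ℤ)) hrk
  exact limitBaseClass_layer_zero_one_ne_zero_of_hasUnitLambda_of_selmerGroup_line_of_tam hB hz hS hloc htam hN h5 hsurj hH hsp hND hall hs hs0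
    hline hNV

end Assembly

end Summit.BirchSwinnertonDyer.BirchSwinnertonDyer.Theorems.SignedBaseChangeAcDivAdmdefRankOneFinrank

end
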